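import Mathlib
import HarnessLib
import Summits.HodgeConjecture.HodgeConjecture.Theorems.Ring2AbelianAllNonsplitGenericDirection

/-!
# No common invariant subspace for the SEMILINEAR Weil tangent family (WEIL-2 gen 26; LEMMA I^gen with the
# conjugation kept)

research route, not a corollary; conditional on HC_CM plus one named minimal statement.

Cell `pub-hodge-ring2-ab-*` (ALL ABELIAN VARIETIES), seat WEIL-2 gen 26, §6 of
`run/shared/lean/pub/pub-hodge-ring2/pub-hodge-ring2-ab-weil-2/STABILIZERS-G26.md`; it upgrades the gen-25 file
`Ring2AbelianAllNonsplitGenericDirection` (p325708), which proved the conjugation-free core, to the statement actually used in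
LIMITS-G25 §2.3 (ii) / STABILIZERS-G26 §3.

Informal setting (not formalised).  On `Y₀ = E_ω⁶` a translated abelian subvariety with tangent space `U ⊂ ℂ⁶ = ℂ³₊ × ℂ³₋`
survives to first order along the Weil direction `κ_X` (`X ∈ M₃(ℂ)`) iff `U` is stable under the CONJUGATE-linear map
`J_X : (u₊, u₋) ↦ (X ū₋, d₋⁻¹ Xᵀ d₊ ū₊)`.  Here the bar is kept: over any field `L` with a ring endomorphism `σ : L →+* L`
(complex conjugation in the application; `σ = id` is p325708's hypothesis, whose Step 3
`eq_top_of_singles_mem` is imported and reused here) and weight vectors `d₁, d₂` with non-zero entries we prove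

* `eq_bot_or_eq_top_of_forall_semilinearWeilTangent_mem` — if a subspace `U ≤ L^ι × L^ι` (`ι` with ≥ 2 elements) satisfies
  `(d₁ • X σ(u₋), d₂ • Xᵀ σ(u₊)) ∈ U` for all `u ∈ U` and ALL square matrices `X`, then `U = ⊥` or `U = ⊤`;
* `exists_matrix_semilinearWeilTangent_not_mem` — contrapositive: every proper non-zero `U` is moved by some `J_X`, i.e. the
  set `B_U` of directions preserving `U` is a proper subspace — so a very general direction preserves no `U` (countably many
  rational `U`), which is how LEMMA I^gen enters the GENERAL BLOCK LEMMA and THEOREM S of STABILIZERS-G26.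

0 sorry, no `def`, no named fact; `HC_CM` does not occur.

## References

* [vanGeemen1994HodgeAV] B. van Geemen, An introduction to the Hodge conjecture for abelian varieties, LNM 1594, §5 —
  the tangent space of a Weil-type family (context only).
-/

namespace Summit.HodgeConjecture.Ring2AbelianAll.NonsplitGenericDirectionSemilinear

open Matrix

variable {L : Type*} [Field L] {ι : Type*} [Fintype ι] [DecidableEq ι]

/-- The value of the semilinear tangent map `J_X` for `X = E_{ab}` on `u = (u₊, u₋)`:
`(d₁ a σ(u₋ b)) e_a , (d₂ b σ(u₊ a)) e_b`.
research route, not a corollary; conditional on HC_CM plus one named minimal statement. [locator STABILIZERS-G26 §6] -/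
theorem semilinearWeilTangent_single_apply (σ : L →+* L) (d₁ d₂ : ι → L) (u : (ι → L) × (ι → L)) (a b : ι) :
    ((fun a' => d₁ a' * ((Matrix.single a b (1 : L)) *ᵥ (fun j => σ (u.2 j))) a',
      fun b' => d₂ b' * ((Matrix.single a b (1 : L))ᵀ *ᵥ (fun i => σ (u.1 i))) b') : (ι → L) × (ι → L))
      = ((d₁ a * σ (u.2 b)) • Pi.single a (1 : L), (d₂ b * σ (u.1 a)) • Pi.single b (1 : L)) := by
  ext i
  · simp only [Matrix.single_mulVec_eq, one_mul, Pi.smul_apply, smul_eq_mul, Pi.single_apply]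
    split_ifs with h
    · subst h; ring
    · ring
  · simp only [Matrix.transpose_single, Matrix.single_mulVec_eq, one_mul, Pi.smul_apply, smul_eq_mul,
      Pi.single_apply]
    split_ifs with h
    · subst h; ring
    · ring

section

variable {σ : L →+* L} {d₁ d₂ : ι → L} {U : Submodule L ((ι → L) × (ι → L))}

/-- **Step 1.** A pure plus vector `(p, 0)` with `p a₀ ≠ 0` in a `J`-stable `U` puts every `(0, e_b)` in `U`
(`X = E_{a₀ b}`; `σ` is injective, so `σ(p a₀) ≠ 0`).
research route, not a corollary; conditional on HC_CM plus one named minimal statement. [locator STABILIZERS-G26 §6] -/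
theorem inr_single_mem_of_inl_mem (hd₂ : ∀ b, d₂ b ≠ 0)
    (hU : ∀ u ∈ U, ∀ X : Matrix ι ι L,
      ((fun a => d₁ a * (X *ᵥ (fun j => σ (u.2 j))) a,
        fun b => d₂ b * (Xᵀ *ᵥ (fun i => σ (u.1 i))) b) : (ι → L) × (ι → L)) ∈ U)
    {p : ι → L} {a₀ : ι} (hp : ((p, 0) : (ι → L) × (ι → L)) ∈ U) (ha : p a₀ ≠ 0) (b : ι) :
    ((0, Pi.single b (1 : L)) : (ι → L) × (ι → L)) ∈ U := by
  have h := hU _ hp (Matrix.single a₀ b 1)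
  rw [semilinearWeilTangent_single_apply] at h
  simp only [Pi.zero_apply, map_zero, mul_zero, zero_smul] at h
  have hc : d₂ b * σ (p a₀) ≠ 0 := mul_ne_zero (hd₂ b) (by rwa [map_ne_zero])
  have h' := U.smul_mem (d₂ b * σ (p a₀))⁻¹ h
  rw [Prod.smul_mk, smul_zero, smul_smul, inv_mul_cancel₀ hc, one_smul] at h'
  exact h'

/-- **Step 2.** Dually, a pure minus vector `(0, q)` with `q b₀ ≠ 0` puts every `(e_a, 0)` in `U` (`X = E_{a b₀}`).
research route, not a corollary; conditional on HC_CM plus one named minimal statement. [locator STABILIZERS-G26 §6] -/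
theorem inl_single_mem_of_inr_mem (hd₁ : ∀ a, d₁ a ≠ 0)
    (hU : ∀ u ∈ U, ∀ X : Matrix ι ι L,
      ((fun a => d₁ a * (X *ᵥ (fun j => σ (u.2 j))) a,
        fun b => d₂ b * (Xᵀ *ᵥ (fun i => σ (u.1 i))) b) : (ι → L) × (ι → L)) ∈ U)
    {q : ι → L} {b₀ : ι} (hq : ((0, q) : (ι → L) × (ι → L)) ∈ U) (hb : q b₀ ≠ 0) (a : ι) :
    ((Pi.single a (1 : L), 0) : (ι → L) × (ι → L)) ∈ U := by
  have h := hU _ hq (Matrix.single a b₀ 1)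
  rw [semilinearWeilTangent_single_apply] at h
  simp only [Pi.zero_apply, map_zero, mul_zero, zero_smul] at h
  have hc : d₁ a * σ (q b₀) ≠ 0 := mul_ne_zero (hd₁ a) (by rwa [map_ne_zero])
  have h' := U.smul_mem (d₁ a * σ (q b₀))⁻¹ h
  rw [Prod.smul_mk, smul_zero, smul_smul, inv_mul_cancel₀ hc, one_smul] at h'
  exact h'

/-- **Step 4.** A pure plus vector with a non-zero entry in a `J`-stable `U` forces `U = ⊤`.
research route, not a corollary; conditional on HC_CM plus one named minimal statement. [locator STABILIZERS-G26 §6] -/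
theorem eq_top_of_inl_mem (hd₁ : ∀ a, d₁ a ≠ 0) (hd₂ : ∀ b, d₂ b ≠ 0)
    (hU : ∀ u ∈ U, ∀ X : Matrix ι ι L,
      ((fun a => d₁ a * (X *ᵥ (fun j => σ (u.2 j))) a,
        fun b => d₂ b * (Xᵀ *ᵥ (fun i => σ (u.1 i))) b) : (ι → L) × (ι → L)) ∈ U)
    {p : ι → L} {a₀ : ι} (hp : ((p, 0) : (ι → L) × (ι → L)) ∈ U) (ha : p a₀ ≠ 0) : U = ⊤ := by
  have h₂ : ∀ b, ((0, Pi.single b (1 : L)) : (ι → L) × (ι → L)) ∈ U :=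
    inr_single_mem_of_inl_mem hd₂ hU hp ha
  have h₁ : ∀ a, ((Pi.single a (1 : L), 0) : (ι → L) × (ι → L)) ∈ U := fun a =>
    inl_single_mem_of_inr_mem (b₀ := a₀) hd₁ hU (h₂ a₀) (by simp) a
  exact NonsplitGenericDirection.eq_top_of_singles_mem h₁ h₂

/-- **Step 4′.** Dually for a pure minus vector.
research route, not a corollary; conditional on HC_CM plus one named minimal statement. [locator STABILIZERS-G26 §6] -/
theorem eq_top_of_inr_mem (hd₁ : ∀ a, d₁ a ≠ 0) (hd₂ : ∀ b, d₂ b ≠ 0)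
    (hU : ∀ u ∈ U, ∀ X : Matrix ι ι L,
      ((fun a => d₁ a * (X *ᵥ (fun j => σ (u.2 j))) a,
        fun b => d₂ b * (Xᵀ *ᵥ (fun i => σ (u.1 i))) b) : (ι → L) × (ι → L)) ∈ U)
    {q : ι → L} {b₀ : ι} (hq : ((0, q) : (ι → L) × (ι → L)) ∈ U) (hb : q b₀ ≠ 0) : U = ⊤ := by
  have h₁ : ∀ a, ((Pi.single a (1 : L), 0) : (ι → L) × (ι → L)) ∈ U :=
    inl_single_mem_of_inr_mem hd₁ hU hq hb
  exact eq_top_of_inl_mem (a₀ := b₀) hd₁ hd₂ hU (h₁ b₀) (by simp)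

/-- **THEOREM (no common invariant subspace for the semilinear Weil tangent family).**  Let `ι` have at least two
elements, `σ : L →+* L` any ring endomorphism (the conjugation), `d₁, d₂ : ι → L` with non-zero entries.  If a subspace
`U ≤ L^ι × L^ι` is stable under every map `(u₊, u₋) ↦ (d₁ • X σ(u₋), d₂ • Xᵀ σ(u₊))` (`X` over ALL `ι × ι` matrices), then
`U = ⊥` or `U = ⊤`.  Proof as in the linear case: a non-zero `u ∈ U` is pure plus, pure minus, or mixed with
`u₊ a₀ ≠ 0 ≠ u₋ b₀`; then for `a ≠ a₀` the vector `J_{E_{a b₀}} u = (c e_a, c′ e_{b₀})` is pure plus with `c ≠ 0` if `u₊ a = 0`,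
and otherwise `J_{E_{a₀ b₀}}` of it is the pure plus vector `c″ e_{a₀}` with `c″ ≠ 0`.
research route, not a corollary; conditional on HC_CM plus one named minimal statement. [locator STABILIZERS-G26 §6] -/
theorem eq_bot_or_eq_top_of_forall_semilinearWeilTangent_mem [Nontrivial ι]
    (hd₁ : ∀ a, d₁ a ≠ 0) (hd₂ : ∀ b, d₂ b ≠ 0)
    (hU : ∀ u ∈ U, ∀ X : Matrix ι ι L,
      ((fun a => d₁ a * (X *ᵥ (fun j => σ (u.2 j))) a,
        fun b => d₂ b * (Xᵀ *ᵥ (fun i => σ (u.1 i))) b) : (ι → L) × (ι → L)) ∈ U) :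
    U = ⊥ ∨ U = ⊤ := by
  rcases eq_or_ne U ⊥ with h | h
  · exact Or.inl h
  right
  obtain ⟨u, hu, hne⟩ := (Submodule.ne_bot_iff U).1 h
  by_cases h1 : u.1 = 0
  · -- pure minus
    have h2 : u.2 ≠ 0 := by
      intro h2; apply hne; ext i <;> simp [h1, h2]
    obtain ⟨b₀, hb⟩ := Function.ne_iff.1 h2
    have hq : ((0, u.2) : (ι → L) × (ι → L)) ∈ U := by
      have : ((0, u.2) : (ι → L) × (ι → L)) = u := by ext i <;> simp [h1]
      rw [this]; exact hu
    exact eq_top_of_inr_mem hd₁ hd₂ hU hq hb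
  by_cases h2 : u.2 = 0
  · -- pure plus
    obtain ⟨a₀, ha⟩ := Function.ne_iff.1 h1
    have hp : ((u.1, 0) : (ι → L) × (ι → L)) ∈ U := by
      have : ((u.1, 0) : (ι → L) × (ι → L)) = u := by ext i <;> simp [h2]
      rw [this]; exact hu
    exact eq_top_of_inl_mem hd₁ hd₂ hU hp ha
  -- mixed
  obtain ⟨a₀, ha⟩ := Function.ne_iff.1 h1
  obtain ⟨b₀, hb⟩ := Function.ne_iff.1 h2
  obtain ⟨a, haa⟩ := exists_ne a₀
  have hv := hU u hu (Matrix.single a b₀ 1)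
  rw [semilinearWeilTangent_single_apply] at hv
  -- hv : ((d₁ a * σ (u.2 b₀)) • e_a, (d₂ b₀ * σ (u.1 a)) • e_{b₀}) ∈ U
  by_cases hua : u.1 a = 0
  · -- the image is pure plus with non-zero a-entry
    rw [hua, map_zero, mul_zero, zero_smul] at hv
    refine eq_top_of_inl_mem (a₀ := a) hd₁ hd₂ hU hv ?_
    have hσ : σ (u.2 b₀) ≠ 0 := by rwa [map_ne_zero]
    simp only [Pi.smul_apply, Pi.single_eq_same, smul_eq_mul, mul_one]
    exact mul_ne_zero (hd₁ a) hσ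
  · -- apply J with X = E_{a₀ b₀} once more: the result is pure plus with non-zero a₀-entry
    have hw := hU _ hv (Matrix.single a₀ b₀ 1)
    rw [semilinearWeilTangent_single_apply] at hw
    simp only [Pi.smul_apply, smul_eq_mul, Pi.single_eq_same, Pi.single_eq_of_ne haa.symm, mul_one,
      mul_zero, map_zero, zero_smul] at hw
    refine eq_top_of_inl_mem (a₀ := a₀) hd₁ hd₂ hU hw ?_
    have hσ : σ (u.1 a) ≠ 0 := by rwa [map_ne_zero]
    have hσ' : σ (d₂ b₀ * σ (u.1 a)) ≠ 0 := by
      rw [map_ne_zero]; exact mul_ne_zero (hd₂ b₀) hσ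
    simp only [Pi.smul_apply, Pi.single_eq_same, smul_eq_mul, mul_one]
    exact mul_ne_zero (hd₁ a₀) hσ'

/-- **COROLLARY (every proper non-zero subspace is moved).**  Contrapositive form used in the account: if `⊥ ≠ U ≠ ⊤` then some
`J_X` moves `U`, i.e. the set of directions preserving `U` is a proper linear subspace of the tangent space; with countably
many rational `U` a very general direction preserves none (LEMMA I^gen), which feeds the GENERAL BLOCK LEMMA and THEOREM S.
research route, not a corollary; conditional on HC_CM plus one named minimal statement. [locator STABILIZERS-G26 §3, §6] -/
theorem exists_matrix_semilinearWeilTangent_not_mem [Nontrivial ι]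
    (hd₁ : ∀ a, d₁ a ≠ 0) (hd₂ : ∀ b, d₂ b ≠ 0) (hbot : U ≠ ⊥) (htop : U ≠ ⊤) :
    ∃ u ∈ U, ∃ X : Matrix ι ι L,
      ((fun a => d₁ a * (X *ᵥ (fun j => σ (u.2 j))) a,
        fun b => d₂ b * (Xᵀ *ᵥ (fun i => σ (u.1 i))) b) : (ι → L) × (ι → L)) ∉ U := by
  by_contra hcon
  have hU : ∀ u ∈ U, ∀ X : Matrix ι ι L,
      ((fun a => d₁ a * (X *ᵥ (fun j => σ (u.2 j))) a,
        fun b => d₂ b * (Xᵀ *ᵥ (fun i => σ (u.1 i))) b) : (ι → L) × (ι → L)) ∈ U := by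
    intro u hu X
    by_contra hX
    exact hcon ⟨u, hu, X, hX⟩
  rcases eq_bot_or_eq_top_of_forall_semilinearWeilTangent_mem hd₁ hd₂ hU with h | h
  · exact hbot h
  · exact htop h

end

/-- Concrete instance for the account: `ι = Fin 3`, any field with an endomorphism `σ` (e.g. `ℂ` with conjugation, or
`ℚ(ω)` with its Galois involution), any non-zero weights — the cell's `(1,1,1)`, `(1,1,½)` and the split sibling's: the
semilinear Weil tangent family of `E_ω⁶` has no common proper non-zero invariant subspace on either side.
research route, not a corollary; conditional on HC_CM plus one named minimal statement. [locator STABILIZERS-G26 §6] -/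
theorem fin3_eq_bot_or_eq_top (σ : L →+* L) {d₁ d₂ : Fin 3 → L} (hd₁ : ∀ a, d₁ a ≠ 0) (hd₂ : ∀ b, d₂ b ≠ 0)
    {U : Submodule L ((Fin 3 → L) × (Fin 3 → L))}
    (hU : ∀ u ∈ U, ∀ X : Matrix (Fin 3) (Fin 3) L,
      ((fun a => d₁ a * (X *ᵥ (fun j => σ (u.2 j))) a,
        fun b => d₂ b * (Xᵀ *ᵥ (fun i => σ (u.1 i))) b) : (Fin 3 → L) × (Fin 3 → L)) ∈ U) :
    U = ⊥ ∨ U = ⊤ :=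
  eq_bot_or_eq_top_of_forall_semilinearWeilTangent_mem hd₁ hd₂ hU

end Summit.HodgeConjecture.Ring2AbelianAll.NonsplitGenericDirectionSemilinear
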